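import Summits.ResolutionOfSingularities.ResolutionOfSingularities.Theorems.PolygonLawKernel
import HarnessLib

/-!
# PolygonLawPort — «PolygonLaw» FILE B (decomp-res lens-4, g43): THE ROOT'S PORT `SurfaceChainPort` PROVED (§151)

Second slice of the g43 node «PolygonLaw» (node header, thesis, honesty and non-vacuity paragraph: `Theorems/PolygonLawKernel.lean`).
Content: SCHEME LAW D in the `x`-grammar; «principal + plane cone ⇒ order `μ` and `τ = 1`» in a regular local ring; principality of the
controlled transform propagates along a point blow-up; chains of blow-ups stay locally of finite type (G-ring stalks); and
`surfaceChainPort_holds : SurfaceChainPort` — the root binder h640 (carried since g31; = Literature `CJS2020_noInfiniteNearChain_eTwo`,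
CossartJannsenSaito2020 Thm. 6.40 for principal point chains, «weaker than print») with ZERO binders.  AI-written; AI review weaker than
expert review.  Not a proof of `MaxContactCut.NoForcedTowers` nor of resolution in dimension `≥ 4`.  No named facts, no ports, no sorry.
-/

noncomputable section

set_option linter.dupNamespace false

open CategoryTheory CategoryTheory.Limits AlgebraicGeometry TopologicalSpace IsLocalRing MvPolynomial
open Literature.AlgebraicGeometry.Resolution Scheme.IdealSheafData
open Summit.ResolutionOfSingularities.ResolutionOfSingularities.Theorems
open WeakOrderReduction ForcedTowerClasses DivergentTowerClasses MonomialTowerClasses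
open HugDimensionClasses HugDimensionKernels SurfaceShadowClasses SurfaceShadowKernels
open NearPointCut (SingularClass)

namespace Summit.ResolutionOfSingularities.ResolutionOfSingularities.Theorems.HugValuationCut

universe u

/-! ## ══ FILE B `Theorems/PolygonLawPort.lean` (§151; imports FILE A) ══ -/

section SurfacePortDischarge

/-! ## §151 (g43 · NEW · KERNEL) THE ROOT'S PORT `SurfaceChainPort` (h640, carried since g31) PROVED — CJS Thm. 6.40 for hypersurface
point chains from LAW D: principality propagates along the chain, «principal + plane cone» gives order `μ` and `τ = 1`, isolation in
`{ord ≥ μ}` from the isolating open set, G-ring stalks from finite type over the field -/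

/-- **SCHEME LAW D in the `x`-grammar**: the same with marked points `x_n ∈ X_n`, `π_n(x_{n+1}) = x_n` (transport of every hypothesis along
`π_n(x_{n+1}) = x_n`). [folklore] -/
theorem false_of_pointChain_tau_one' (Xs : ℕ → Scheme.{u})
    (hN : ∀ n, IsLocallyNoetherian (Xs n)) (hXreg : ∀ n, Scheme.IsRegular (Xs n))
    (π : ∀ n, Xs (n + 1) ⟶ Xs n) (x : ∀ n, Xs n) (J : ∀ n, (Xs n).IdealSheafData) {μ : ℕ} (hμ : 1 ≤ μ)
    (hx : ∀ n, π n (x (n + 1)) = x n)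
    (hcl : ∀ n, IsClosed ({x n} : Set (Xs n)))
    (hπ : ∀ n, IsBlowup (π n) (vanishingIdeal ⟨{x n}, hcl n⟩))
    (hJ : ∀ n, J (n + 1) = controlledTransform (π n) (vanishingIdeal ⟨{x n}, hcl n⟩) (J n) μ)
    (hordx : ∀ n, idealOrder (J n) (x n) = μ)
    (hd : ∀ n, (maximalIdeal ((Xs n).presheaf.stalk (x n))).spanFinrank = 3)
    (hnear : ∀ n, IsNear (π n) (vanishingIdeal ⟨{x n}, hcl n⟩) (J n) μ (x (n + 1)))
    (hτ : ∀ n, @stalkTau (Xs n) (J n) (x n) (hXreg n (x n)) μ = 1)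
    (hG : ∀ n, IsGRing ((Xs n).presheaf.stalk (x n)))
    (hisol : ∀ n (𝔮 : Ideal ((Xs n).presheaf.stalk (x n))) [𝔮.IsPrime], 𝔮 ≠ maximalIdeal _ →
      ¬ (stalkIdeal (J n) (x n)).map (algebraMap _ (Localization.AtPrime 𝔮)) ≤ maximalIdeal (Localization.AtPrime 𝔮) ^ μ) :
    False := by
  have hcl' : ∀ n, IsClosed ({π n (x (n + 1))} : Set (Xs n)) := fun n => by rw [hx n]; exact hcl n
  have hC : ∀ n, (⟨{π n (x (n + 1))}, hcl' n⟩ : Closeds (Xs n)) = ⟨{x n}, hcl n⟩ := fun n => by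
    ext q
    change q ∈ ({π n (x (n + 1))} : Set (Xs n)) ↔ q ∈ ({x n} : Set (Xs n))
    rw [hx n]
  refine false_of_pointChain_tau_one Xs hN hXreg π (fun n => x (n + 1)) J hμ (fun n => hx (n + 1)) hcl'
    (fun n => by rw [hC n]; exact hπ n) (fun n => by rw [hC n]; exact hJ n)
    (fun n => by rw [hx n]; exact hordx n) ?_ (fun n => by rw [hC n]; exact hnear n) ?_ ?_ ?_
  · intro n
    have key : ∀ q : Xs n, q = x n → (maximalIdeal ((Xs n).presheaf.stalk q)).spanFinrank = 3 := by
      rintro q rfl; exact hd n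
    exact key _ (hx n)
  · intro n
    have key : ∀ q : Xs n, q = x n → @stalkTau (Xs n) (J n) q (hXreg n q) μ = 1 := by
      rintro q rfl; exact hτ n
    exact key _ (hx n)
  · intro n
    have key : ∀ q : Xs n, q = x n → IsGRing ((Xs n).presheaf.stalk q) := by
      rintro q rfl; exact hG n
    exact key _ (hx n)
  · intro n
    have key : ∀ q : Xs n, q = x n → ∀ (𝔮 : Ideal ((Xs n).presheaf.stalk q)) [𝔮.IsPrime], 𝔮 ≠ maximalIdeal _ →
        ¬ (stalkIdeal (J n) q).map (algebraMap _ (Localization.AtPrime 𝔮)) ≤ maximalIdeal (Localization.AtPrime 𝔮) ^ μ := by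
      rintro q rfl; exact hisol n
    exact key _ (hx n)

/-- **«PRINCIPAL + PLANE CONE» in a regular local ring**: if `I = (g) ⊆ 𝔪^μ` and some `f ∈ I` satisfies `f ≡ c·z^μ (mod 𝔪^(μ+1))` with
`c` a unit and `z ∈ 𝔪 ∖ 𝔪²`, then `I` has order EXACTLY `μ` (Cutkosky's `HasOrder`) and `τ = 1` shape `I ⊆ (z^μ) + 𝔪^(μ+1)`
(Cutkosky's `TauOne`).  (`c·z^μ ∉ 𝔪^(μ+1)` by `mul_not_mem_pow_of_not_mem_pow`; `f = a·g` forces `a` to be a unit.) [folklore] -/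
theorem hasOrder_tauOne_of_isPrincipal_of_cone {R : Type u} [CommRing R] [IsRegularLocalRing R] {I : Ideal R} {μ : ℕ}
    (hI : I.IsPrincipal) (hIμ : I ≤ maximalIdeal R ^ μ)
    (hcone : ∃ z ∈ maximalIdeal R, z ∉ maximalIdeal R ^ 2 ∧ ∃ f ∈ I, ∃ c : R, IsUnit c ∧ f - c * z ^ μ ∈ maximalIdeal R ^ (μ + 1)) :
    Cutkosky2009.HasOrder I μ ∧ Cutkosky2009.TauOne I μ := by
  classical
  obtain ⟨z, hz, hz2, f, hfI, c, hc, hf⟩ := hcone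
  have hcz : c * z ^ μ ∉ maximalIdeal R ^ (μ + 1) := by
    have h1 : c ∉ maximalIdeal R ^ (0 + 1) := by
      rw [zero_add, pow_one]
      exact fun h => (mem_nonunits_iff.mp ((IsLocalRing.mem_maximalIdeal c).mp h)) hc
    have h2 : z ^ μ ∉ maximalIdeal R ^ (μ * 1 + 1) := pow_not_mem_pow_of_not_mem_pow hz2 μ
    have h := mul_not_mem_pow_of_not_mem_pow h1 h2
    rwa [mul_one, zero_add] at h
  have hf' : f ∉ maximalIdeal R ^ (μ + 1) := fun h => hcz (by simpa using sub_mem h hf)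
  haveI := hI
  obtain ⟨g, hg⟩ := Submodule.IsPrincipal.principal I
  have hgI : g ∈ I := by rw [hg]; exact Submodule.mem_span_singleton_self g
  obtain ⟨a, ha⟩ : ∃ a, a * g = f := Ideal.mem_span_singleton'.mp (by rw [hg] at hfI; exact hfI)
  have haU : IsUnit a := by
    by_contra hna
    have ham : a ∈ maximalIdeal R := (IsLocalRing.mem_maximalIdeal a).mpr (mem_nonunits_iff.mpr hna)
    apply hf'
    rw [← ha, pow_succ']
    exact Ideal.mul_mem_mul ham (hIμ hgI)
  refine ⟨⟨hIμ, fun h => hf' (h hfI)⟩, z, hz, hz2, ?_⟩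
  obtain ⟨v, rfl⟩ := haU
  have hg' : g = ↑v⁻¹ * f := by rw [← ha, ← mul_assoc, Units.inv_mul, one_mul]
  have hfmem : f ∈ Ideal.span {z ^ μ} ⊔ maximalIdeal R ^ (μ + 1) := by
    have e : f = c * z ^ μ + (f - c * z ^ μ) := by ring
    rw [e]
    exact Submodule.add_mem_sup (Ideal.mem_span_singleton'.mpr ⟨c, rfl⟩) hf
  intro r hr
  rw [hg] at hr
  obtain ⟨b, rfl⟩ := Ideal.mem_span_singleton'.mp hr
  rw [hg']
  exact Ideal.mul_mem_left _ _ (Ideal.mul_mem_left _ _ hfmem)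

/-- **`τ = 1` at a point of embedding dimension `3` from «principal + plane cone»** (`stalkTau` for ANY regular system of parameters,
`stalkTau_eq`; Cutkosky's `hironakaTauAt_eq_one_of_tauOne`). [cite: Cutkosky2009, Lemma 3.3 (τ ≥ 1 case)] -/
theorem stalkTau_eq_one_of_isPrincipal_of_cone {X : Scheme.{u}} (J : X.IdealSheafData) (x : X)
    [IsRegularLocalRing (X.presheaf.stalk x)] (hd : (maximalIdeal (X.presheaf.stalk x)).spanFinrank = 3)
    (hdim : ringKrullDim (X.presheaf.stalk x) = 3) {μ : ℕ} (hμ : 1 ≤ μ)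
    (hI : (stalkIdeal J x).IsPrincipal) (hIμ : stalkIdeal J x ≤ maximalIdeal _ ^ μ)
    (hcone : ∃ z ∈ maximalIdeal (X.presheaf.stalk x), z ∉ maximalIdeal (X.presheaf.stalk x) ^ 2 ∧
      ∃ f ∈ stalkIdeal J x, ∃ c : X.presheaf.stalk x, IsUnit c ∧ f - c * z ^ μ ∈ maximalIdeal (X.presheaf.stalk x) ^ (μ + 1)) :
    stalkTau J x μ = 1 := by
  obtain ⟨hord, hτ1⟩ := hasOrder_tauOne_of_isPrincipal_of_cone hI hIμ hcone
  obtain ⟨c, hc⟩ : ∃ c : Fin 3 → X.presheaf.stalk x, Ideal.span (Set.range c) = maximalIdeal _ := by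
    obtain ⟨c, hc⟩ := exists_regularSystemOfParameters (R := X.presheaf.stalk x)
    exact ⟨c ∘ finCongr hd.symm, by rw [(finCongr hd.symm).surjective.range_comp]; exact hc⟩
  rw [stalkTau_eq J x μ hd c hc]
  exact Cutkosky2009.hironakaTauAt_eq_one_of_tauOne c (by rw [← range_fin_three']; exact hc) hdim (by omega) hord hτ1

/-- **PRINCIPALITY PROPAGATES along a point blow-up** (regular target, weak transform not the unit ideal): at a point `x'` over the
reduced closed point `π(x')` with `J_{π x'} = (g) ⊆ 𝔪^μ`, the controlled transform is `(J𝒪_{x'} : u^μ) = (t)` where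
`g ↦ t·u^μ`, `u` the exceptional parameter (`𝔪𝒪_{x'} = (u)`). [folklore] -/
theorem isPrincipal_stalkIdeal_controlledTransform_point {X X' : Scheme.{u}} [IsLocallyNoetherian X] [IsLocallyNoetherian X']
    {π : X' ⟶ X} {Y : Closeds X} (hπ : IsBlowup π (vanishingIdeal Y)) (J : X.IdealSheafData) {μ : ℕ} (hμ : 1 ≤ μ) (x' : X')
    [IsRegularLocalRing (X'.presheaf.stalk x')]
    (hY : stalkIdeal (vanishingIdeal Y) (π x') = maximalIdeal _)
    (hJp : (stalkIdeal J (π x')).IsPrincipal) (hJμ : stalkIdeal J (π x') ≤ maximalIdeal _ ^ μ)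
    (hne : stalkIdeal (controlledTransform π (vanishingIdeal Y) J μ) x' ≠ ⊤) :
    (stalkIdeal (controlledTransform π (vanishingIdeal Y) J μ) x').IsPrincipal := by
  classical
  haveI : IsDomain (X'.presheaf.stalk x') := isDomain_of_isRegularLocalRing _
  obtain ⟨w, hw⟩ := CP2008Prop44.exists_map_stalkIdeal_centre_eq_span_congr hπ x' rfl
  have hJ' := CP2008Prop44.stalkIdeal_controlledTransform_eq_colon_of_map_eq_span_congr Y J μ x' rfl w hw
  rw [hY] at hw
  haveI := hJp
  obtain ⟨g, hg⟩ := Submodule.IsPrincipal.principal (stalkIdeal J (π x'))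
  have hφg : stalkMapCongr π x' x' rfl g ∈ Ideal.span {w ^ μ} := by
    rw [← Ideal.span_singleton_pow, ← hw, ← Ideal.map_pow]
    exact Ideal.mem_map_of_mem _ (hJμ (by rw [hg]; exact Submodule.mem_span_singleton_self g))
  obtain ⟨t, ht⟩ := Ideal.mem_span_singleton'.mp hφg
  have hmap : (stalkIdeal J (π x')).map (stalkMapCongr π x' x' rfl) = Ideal.span {t * w ^ μ} := by
    rw [hg]
    change (Ideal.span {g}).map (stalkMapCongr π x' x' rfl) = _
    rw [Ideal.map_span, Set.image_singleton, ht]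
  rw [hJ', hmap] at hne ⊢
  by_cases hw0 : w = 0
  · exfalso
    apply hne
    rw [eq_top_iff]
    intro r _
    rw [Submodule.mem_colon_singleton, hw0, zero_pow (by omega), smul_zero]
    exact Submodule.zero_mem _
  · have hwμ : w ^ μ ≠ 0 := pow_ne_zero _ hw0
    refine ⟨⟨t, ?_⟩⟩
    ext r
    rw [Submodule.mem_colon_singleton, smul_eq_mul]
    change r * w ^ μ ∈ Ideal.span {t * w ^ μ} ↔ r ∈ Ideal.span {t}
    rw [Ideal.mem_span_singleton', Ideal.mem_span_singleton']
    constructor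
    · rintro ⟨a, ha⟩
      exact ⟨a, mul_right_cancel₀ hwμ (by rw [← ha]; ring)⟩
    · rintro ⟨a, rfl⟩
      exact ⟨a, by ring⟩

/-- the composite `X_n ⟶ X_0` of the first `n` blow-ups of a chain. -/
def chainToRoot (Xs : ℕ → Scheme.{u}) (π : ∀ n, Xs (n + 1) ⟶ Xs n) : ∀ n, Xs n ⟶ Xs 0
  | 0 => 𝟙 (Xs 0)
  | n + 1 => π n ≫ chainToRoot Xs π n

/-- a chain of point blow-ups over a scheme locally of finite type over a field stays locally of finite type over the field (blow-ups are
proper). [folklore] -/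
theorem locallyOfFiniteType_chainToRoot {k : Type u} [Field k] (Xs : ℕ → Scheme.{u}) [∀ n, IsLocallyNoetherian (Xs n)]
    (π : ∀ n, Xs (n + 1) ⟶ Xs n) (g : Xs 0 ⟶ Spec (.of k)) (hg : LocallyOfFiniteType g)
    (hπ : ∀ n, ∃ I : (Xs n).IdealSheafData, IsBlowup (π n) I) (n : ℕ) : LocallyOfFiniteType (chainToRoot Xs π n ≫ g) := by
  induction n with
  | zero =>
    show LocallyOfFiniteType (𝟙 _ ≫ g)
    rw [Category.id_comp]; exact hg
  | succ n ih =>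
    obtain ⟨I, hI⟩ := hπ n
    haveI : IsProper (π n) := hI.isProper
    show LocallyOfFiniteType ((π n ≫ chainToRoot Xs π n) ≫ g)
    rw [Category.assoc]
    infer_instance

/-- **THE PORT `SurfaceChainPort` PROVED (h640 DISCHARGED)** — Cossart–Jannsen–Saito Thm. 6.40 for point chains of a principal weighted
ideal on regular threefolds: there is no infinite chain of closed-point blow-ups `x_{n+1} ↦ x_n` near for `(J_n, μ)`, `μ ≥ 2`, with
`J_0` principal at `x_0`, `ord J_n ≤ μ` everywhere and `J_n𝒪_{x_n} ⊆ 𝔪^μ`, a plane cone `in_μ f = c̄·Z^μ` and `x_n` isolated in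
`{ord ≥ μ}` at every level.  Proof: principality propagates (`isPrincipal_stalkIdeal_controlledTransform_point`), «principal + plane
cone» gives `ord = μ` and `τ = 1` (`stalkTau_eq_one_of_isPrincipal_of_cone`), stalks are G-rings (finite type over `k`,
`locallyOfFiniteType_chainToRoot`), the isolating open set gives isolation after localisation (`not_map_le_pow_of_isolated`); then SCHEME
LAW D.  VERBATIM the landed `def SurfaceChainPort` (Theorems/SurfacePort :161), zero binders. [cite: CossartJannsenSaito2020, Thm. 6.40,
Thm. 13.7] -/
theorem surfaceChainPort_holds : SurfaceChainPort := by
  intro k _ Xs _ g hg hXreg π x J μ hμ2 hxmap hcl hπ hdim3 hprin hJ hbd hJμ hnear hcone hisolU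
  have hμ : 1 ≤ μ := by omega
  haveI hR : ∀ n, IsRegularLocalRing ((Xs n).presheaf.stalk (x n)) := fun n => hXreg n _
  have hx : ∀ n, π n (x (n + 1)) = x n := hxmap
  have hd : ∀ n, (maximalIdeal ((Xs n).presheaf.stalk (x n))).spanFinrank = 3 := by
    intro n
    have h := IsRegularLocalRing.spanFinrank_maximalIdeal (R := (Xs n).presheaf.stalk (x n))
    rw [hdim3 n] at h
    exact_mod_cast h
  have hordx : ∀ n, idealOrder (J n) (x n) = μ := fun n =>
    le_antisymm (hbd n (x n)) ((le_idealOrder_iff _ _ _).mpr (hJμ n))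
  -- principality propagates along the chain
  have hprin_n : ∀ n, (stalkIdeal (J n) (x n)).IsPrincipal := by
    intro n
    induction n with
    | zero => exact hprin
    | succ n ih =>
      have hne : stalkIdeal (controlledTransform (π n) (vanishingIdeal ⟨{x n}, hcl n⟩) (J n) μ) (x (n + 1)) ≠ ⊤ := by
        intro h
        have h1 := hJμ (n + 1)
        rw [hJ n, h] at h1
        have h2 : (1 : (Xs (n + 1)).presheaf.stalk (x (n + 1))) ∈ maximalIdeal _ :=
          Ideal.pow_le_self (by omega) (h1 Submodule.mem_top)
        exact (IsLocalRing.maximalIdeal.isMaximal _).ne_top (Ideal.eq_top_of_isUnit_mem _ h2 isUnit_one)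
      have key : ∀ q : Xs n, q = x n → (stalkIdeal (J n) q).IsPrincipal ∧ stalkIdeal (J n) q ≤ maximalIdeal _ ^ μ ∧
          stalkIdeal (vanishingIdeal ⟨{x n}, hcl n⟩) q = maximalIdeal _ := by
        rintro q rfl; exact ⟨ih, hJμ n, stalkIdeal_vanishingIdeal_singleton (hcl n)⟩
      obtain ⟨k1, k2, k3⟩ := key _ (hx n)
      rw [hJ n]
      exact isPrincipal_stalkIdeal_controlledTransform_point (hπ n) (J n) hμ (x (n + 1)) k3 k1 k2 hne
  -- `τ = 1` at every level
  have hτ : ∀ n, stalkTau (J n) (x n) μ = 1 := fun n =>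
    stalkTau_eq_one_of_isPrincipal_of_cone (J n) (x n) (hd n) (hdim3 n) hμ (hprin_n n) (hJμ n) (hcone n)
  -- G-ring stalks
  have hG : ∀ n, IsGRing ((Xs n).presheaf.stalk (x n)) := fun n =>
    haveI := locallyOfFiniteType_chainToRoot Xs π g hg (fun n => ⟨_, hπ n⟩) n
    isGRing_stalk_of_locallyOfFiniteType (chainToRoot Xs π n ≫ g) (x n)
  -- isolation after localisation
  have hisol : ∀ n (𝔮 : Ideal ((Xs n).presheaf.stalk (x n))) [𝔮.IsPrime], 𝔮 ≠ maximalIdeal _ →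
      ¬ (stalkIdeal (J n) (x n)).map (algebraMap _ (Localization.AtPrime 𝔮)) ≤ maximalIdeal (Localization.AtPrime 𝔮) ^ μ := by
    intro n 𝔮 _ h𝔮
    obtain ⟨U, hxU, hU⟩ := hisolU n
    exact not_map_le_pow_of_isolated (J n) (x n) μ (fun ζ hζ hne hle => hne (hU ζ (hζ.mem_open U.isOpen hxU) hle)) 𝔮 h𝔮
  exact false_of_pointChain_tau_one' Xs (fun n => inferInstance) hXreg π x J hμ hx hcl hπ hJ hordx hd hnear (fun n => hτ n) hG hisol

/-- **THE SURFACE COLUMN BY THE PORT'S OWN ROUTE, now port-free**: g31's `noTower_surfaceColumn_of_port` fed with the proved port.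
[folklore] -/
theorem noTower_surfaceColumn' {n : ℕ} (hn : 2 ≤ n) (P : ForcedTower → Prop) :
    NoTower n fun T => P T ∧ SurfaceColumn n T :=
  noTower_surfaceColumn_of_port surfaceChainPort_holds hn P

end SurfacePortDischarge

end Summit.ResolutionOfSingularities.ResolutionOfSingularities.Theorems.HugValuationCut

end
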